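import Literature.NumberTheory.EllipticCurves.IwasawaModuleFinitePadicIntProofs
import Literature.NumberTheory.EllipticCurves.IwasawaAlgebraDivisibilityProofs
import HarnessLib

/-!
# Route `SignedLowerHalves` (K3), crux M `SmallImageMuZeroOneSign` (item stmt-BirchSwinnertonDyer-23600), line `birth_mu` —
# the FINE PIVOT, part 1: local lengths at `(p)` of quotients of `Λ`-modules (generic algebra)

LEAD seat `cruxlead-stmt-BirchSwinnertonDyer-23600` gen 2 (cell `bsd-ssimc`; helper file, `--supports stmt-BirchSwinnertonDyer-23600`;
theorems only, no definition, no named fact).  This is the algebra under the crux idea «fine-pivot-minsign» (item evidence #5–#8,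
bsd-idea-5 g10): Coates–Sujatha's Conjecture A at a pair `(E, p)` (`μ(X₀(E/ℚ_∞)) = 0`) forces ALGEBRAIC `μ(X^ε(E/ℚ_∞)) = 0` for ONE of
Kobayashi's two signs, by a RESIDUAL corank count (no `p`-adic `L`-function, no main conjecture, no image hypothesis).  Part 2
(`…FinePivotDichotomy.lean`) is the count for abstract Pontryagin dual pairs; part 3 (`…FinePivot.lean`) is the number theory and the crux
BY NAME from Conjecture A.  HONEST FRAMING: nothing about any curve is asserted here; crux M, crux 4 and BSD are NOT proved by this file.

## Contents (`Λ = ℤ_p⟦T⟧ = IwasawaAlgebra p`, `𝔭 = (p) = augIdealP p`, `ℓ_𝔭 = Module.lengthAt`)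
* §1 `lengthAt_quot_inf_add_lengthAt_quot_sup` — the modular identity `ℓ(M/(U ⊓ V)) + ℓ(M/(U ⊔ V)) = ℓ(M/U) + ℓ(M/V)`.
* §2 `lengthAt_eq_zero_of_finite'` (finite ⟹ `ℓ_𝔭 = 0`), `lengthAt_eq_zero_of_lengthAt_quot_eq_zero` (Nakayama: `ℓ_𝔭(M/pM) = 0 ⟹ ℓ_𝔭(M) = 0`).
* §3 `ℓ_𝔭(N/IN) = ℓ_𝔭(M/(ker π ⊔ IM))` for `π : M ↠ N`; right exactness `ℓ_𝔭(M/IM) ≤ ℓ_𝔭(P/IP) + ℓ_𝔭(N/IN)` along `P → M ↠ N`.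
* §4 `lengthAt_quot_le_one_of_extension` — for `0 → (Λ × Λ)/Λv → X → Y → 0` with `v ≠ 0`, `ℓ_𝔭(tors X) = 0` and `ℓ_𝔭(Y/pY) = 0`:
  `ℓ_𝔭(X/pX) ≤ 1` (the residual shadow of "`rank X = 1` and `μ(tors X) = 0`"; `Λ/p` is a domain).
References: [Washington1997] §13.2; [BourbakiAC5to7] VII §4.4–4.5; [KuriharaPollack2007] §3 p. 328 (the extension this is applied to).
-/

set_option autoImplicit false
set_option linter.dupNamespace false

noncomputable section

open scoped Classical

namespace Summit.BirchSwinnertonDyer.BirchSwinnertonDyer.Theorems.SmallImageFinePivot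

open Literature.NumberTheory.EllipticCurves Literature.NumberTheory.EllipticCurves.Module
  Literature.NumberTheory.EllipticCurves.IwasawaAlgebra

/-! ### §1 Generic algebra: local lengths of quotients -/

section Lengths

variable {R : Type*} [CommRing R] {M : Type*} [AddCommGroup M] [Module R M]

/-- The modular identity of local lengths: `ℓ_𝔭(M/(U ⊓ V)) + ℓ_𝔭(M/(U ⊔ V)) = ℓ_𝔭(M/U) + ℓ_𝔭(M/V)`,
from the exact sequence `0 → M/(U ⊓ V) → M/U × M/V → M/(U ⊔ V) → 0`. [folklore] -/
theorem lengthAt_quot_inf_add_lengthAt_quot_sup (U V : Submodule R M) (𝔭 : PrimeSpectrum R) :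
    lengthAt R (M ⧸ (U ⊓ V)) 𝔭 + lengthAt R (M ⧸ (U ⊔ V)) 𝔭 =
      lengthAt R (M ⧸ U) 𝔭 + lengthAt R (M ⧸ V) 𝔭 := by
  -- `f : M/(U ⊓ V) → M/U × M/V`, `g : M/U × M/V → M/(U ⊔ V)`, `(x̄, ȳ) ↦ x̄ - ȳ`
  let f : (M ⧸ (U ⊓ V)) →ₗ[R] (M ⧸ U) × (M ⧸ V) :=
    LinearMap.prod (Submodule.factor inf_le_left) (Submodule.factor inf_le_right)
  let g : (M ⧸ U) × (M ⧸ V) →ₗ[R] M ⧸ (U ⊔ V) :=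
    (Submodule.factor (le_sup_left : U ≤ U ⊔ V)).coprod (-(Submodule.factor (le_sup_right : V ≤ U ⊔ V)))
  have hf_apply : ∀ x : M, f (Submodule.Quotient.mk x) = (Submodule.Quotient.mk x, Submodule.Quotient.mk x) :=
    fun x ↦ rfl
  have hg_apply : ∀ x y : M,
      g (Submodule.Quotient.mk x, Submodule.Quotient.mk y) = Submodule.Quotient.mk (x - y) := by
    intro x y
    change (Submodule.Quotient.mk x : M ⧸ (U ⊔ V)) + -(Submodule.Quotient.mk y : M ⧸ (U ⊔ V)) = _
    rw [← sub_eq_add_neg, Submodule.Quotient.mk_sub]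
  have hf : Function.Injective f := by
    rw [injective_iff_map_eq_zero]
    intro z hz
    obtain ⟨x, rfl⟩ := Submodule.Quotient.mk_surjective _ z
    rw [hf_apply, Prod.mk_eq_zero, Submodule.Quotient.mk_eq_zero, Submodule.Quotient.mk_eq_zero] at hz
    exact (Submodule.Quotient.mk_eq_zero _).mpr ⟨hz.1, hz.2⟩
  have hg : Function.Surjective g := by
    intro z
    obtain ⟨x, rfl⟩ := Submodule.Quotient.mk_surjective _ z
    refine ⟨(Submodule.Quotient.mk x, Submodule.Quotient.mk 0), ?_⟩
    rw [hg_apply, sub_zero]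
  have hfg : Function.Exact f g := by
    intro y
    obtain ⟨a, b⟩ := y
    obtain ⟨x, rfl⟩ := Submodule.Quotient.mk_surjective _ a
    obtain ⟨y, rfl⟩ := Submodule.Quotient.mk_surjective _ b
    rw [hg_apply, Submodule.Quotient.mk_eq_zero, Submodule.mem_sup]
    constructor
    · rintro ⟨u, hu, v, hv, huv⟩
      refine ⟨Submodule.Quotient.mk (x - u), ?_⟩
      rw [hf_apply, Prod.mk.injEq]
      refine ⟨(Submodule.Quotient.eq _).mpr ?_, (Submodule.Quotient.eq _).mpr ?_⟩
      · have : x - u - x = -u := by abel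
        rw [this]; exact U.neg_mem hu
      · have : x - u - y = v := by
          calc x - u - y = (x - y) - u := by abel
            _ = (u + v) - u := by rw [huv]
            _ = v := by abel
        rw [this]; exact hv
    · rintro ⟨w, hw⟩
      obtain ⟨z, rfl⟩ := Submodule.Quotient.mk_surjective _ w
      rw [hf_apply, Prod.mk.injEq, Submodule.Quotient.eq, Submodule.Quotient.eq] at hw
      refine ⟨-(z - x), U.neg_mem hw.1, z - y, hw.2, by abel⟩
  have := lengthAt_eq_add_of_exact f g hf hg hfg 𝔭
  rw [lengthAt_prod] at this
  rw [← this]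

/-- Monotonicity: for `N ≤ N'`, `ℓ_𝔭(M/N') ≤ ℓ_𝔭(M/N)`. [folklore] -/
theorem lengthAt_quot_le_of_le {N N' : Submodule R M} (h : N ≤ N') (𝔭 : PrimeSpectrum R) :
    lengthAt R (M ⧸ N') 𝔭 ≤ lengthAt R (M ⧸ N) 𝔭 :=
  lengthAt_le_of_surjective (Submodule.factor h) (Submodule.factor_surjective h) 𝔭

end Lengths

/-! ### §2 Over `Λ = ℤ_p⟦T⟧` at the height-one prime `(p)` -/

section Lambda

variable {p : ℕ} [Fact p.Prime]

/-- A FINITE `Λ`-module has local length `0` at `(p)`: it is killed by a power of `T`, which is not in `(p)`.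
[cite: Washington1997, §13.2] -/
theorem lengthAt_eq_zero_of_finite' (M : Type*) [AddCommGroup M] [Module (IwasawaAlgebra p) M] [Finite M]
    (𝔭 : PrimeSpectrum (IwasawaAlgebra p)) (h𝔭 : 𝔭.asIdeal = augIdealP p) :
    lengthAt (IwasawaAlgebra p) M 𝔭 = 0 := by
  obtain ⟨k, hk⟩ := IwasawaModuleFinitePadicInt.exists_pow_X_smul_eq_zero_of_finite p M
  refine lengthAt_eq_zero_of_isTorsionBy (s := (PowerSeries.X : IwasawaAlgebra p) ^ k) (fun m ↦ hk m) 𝔭 ?_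
  rw [h𝔭, mem_augIdealP_iff, not_forall]
  refine ⟨k, ?_⟩
  rw [PowerSeries.coeff_X_pow_self]
  exact fun h ↦ (PadicInt.irreducible_p (p := p)).not_isUnit (isUnit_of_dvd_one h)

/-- **Nakayama at `(p)`**: for a finitely generated `Λ`-module `M`, if `ℓ_𝔭(M/(p)M) = 0` at `𝔭 = (p)` then
`ℓ_𝔭(M) = 0` (`M_𝔭 = p M_𝔭` and `p` lies in the maximal ideal of the local ring `Λ_𝔭`). [folklore] -/
theorem lengthAt_eq_zero_of_lengthAt_quot_eq_zero (M : Type*) [AddCommGroup M] [Module (IwasawaAlgebra p) M]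
    [Module.Finite (IwasawaAlgebra p) M]
    (𝔭 : PrimeSpectrum (IwasawaAlgebra p)) (h𝔭 : 𝔭.asIdeal = augIdealP p)
    (h : lengthAt (IwasawaAlgebra p) (M ⧸ (augIdealP p • (⊤ : Submodule (IwasawaAlgebra p) M))) 𝔭 = 0) :
    lengthAt (IwasawaAlgebra p) M 𝔭 = 0 := by
  set S := 𝔭.asIdeal.primeCompl with hS
  set Rp := Localization.AtPrime 𝔭.asIdeal
  set π : IwasawaAlgebra p := PowerSeries.C (p : ℤ_[p]) with hπ
  rw [lengthAt_eq_zero_iff] at h ⊢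
  -- every `x ∈ M` has `t • x ∈ π • M` for some `t ∉ 𝔭`
  have hstep : ∀ x : M, ∃ t ∈ S, ∃ y : M, t • x = π • y := by
    intro x
    have h0 : (LocalizedModule.mkLinearMap S (M ⧸ (augIdealP p • (⊤ : Submodule (IwasawaAlgebra p) M)))
        (Submodule.Quotient.mk x)) = 0 := Subsingleton.elim _ _
    rw [LocalizedModule.mkLinearMap_apply, ← LocalizedModule.zero_mk 1, LocalizedModule.mk_eq] at h0
    obtain ⟨u, hu⟩ := h0
    simp only [smul_zero, one_smul] at hu
    -- `hu : u • Submodule.Quotient.mk x = 0`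
    have hux : (u : IwasawaAlgebra p) • x ∈ augIdealP p • (⊤ : Submodule (IwasawaAlgebra p) M) := by
      rw [← Submodule.Quotient.mk_eq_zero, Submodule.Quotient.mk_smul]
      exact hu
    rw [show augIdealP p = Ideal.span {π} from rfl, Submodule.ideal_span_singleton_smul,
      Submodule.mem_smul_pointwise_iff_exists] at hux
    obtain ⟨y, -, hy⟩ := hux
    exact ⟨u, u.2, y, hy.symm⟩
  -- Nakayama in the local ring `Λ_𝔭`: `M_𝔭 ≤ 𝔪 • M_𝔭`
  haveI : Module.Finite Rp (LocalizedModule S M) := inferInstance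
  have hle : (⊤ : Submodule Rp (LocalizedModule S M)) ≤ IsLocalRing.maximalIdeal Rp • ⊤ := by
    intro m _
    induction m using LocalizedModule.induction_on with
    | h x s =>
      obtain ⟨t, ht, y, hy⟩ := hstep x
      have hmk : LocalizedModule.mk x s =
          (algebraMap (IwasawaAlgebra p) Rp π) • LocalizedModule.mk y (⟨t, ht⟩ * s) := by
        rw [algebraMap_smul, LocalizedModule.smul'_mk, ← hy, LocalizedModule.mk_eq]
        refine ⟨1, ?_⟩
        simp only [one_smul, Submonoid.smul_def, mul_smul]
        exact smul_comm _ _ _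
      rw [hmk]
      refine Submodule.smul_mem_smul ?_ Submodule.mem_top
      rw [← Localization.AtPrime.map_eq_maximalIdeal]
      apply Ideal.mem_map_of_mem
      rw [h𝔭]
      exact Ideal.mem_span_singleton_self π
  have htop : (⊤ : Submodule Rp (LocalizedModule S M)) = ⊥ :=
    Submodule.eq_bot_of_le_smul_of_le_jacobson_bot _ ⊤ Module.Finite.fg_top hle
      (IsLocalRing.maximalIdeal_le_jacobson ⊥)
  exact subsingleton_of_forall_eq 0 fun m ↦ (Submodule.mem_bot Rp).mp (htop ▸ Submodule.mem_top)

end Lambda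

/-! ### §3 Quotients by an ideal along maps; the residual length of `Λ²/Λv` -/

section QuotIdeal

variable {R : Type*} [CommRing R] {M N : Type*} [AddCommGroup M] [Module R M] [AddCommGroup N] [Module R N]

/-- For `N ≤ N'`: `ℓ_𝔭(M/N) = ℓ_𝔭(N'/N) + ℓ_𝔭(M/N')`. [folklore] -/
theorem lengthAt_quot_eq_add_of_le {S S' : Submodule R M} (h : S ≤ S') (𝔭 : PrimeSpectrum R) :
    lengthAt R (M ⧸ S) 𝔭 = lengthAt R (S'.map S.mkQ) 𝔭 + lengthAt R (M ⧸ S') 𝔭 := by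
  rw [lengthAt_eq_add_of_exact (S'.map S.mkQ).subtype (S'.map S.mkQ).mkQ (Submodule.subtype_injective _)
    (Submodule.mkQ_surjective _) (LinearMap.exact_subtype_mkQ _) 𝔭,
    lengthAt_eq_of_linearEquiv (Submodule.quotientQuotientEquivQuotient S S' h)]

/-- For a surjective `π : M → N` and an ideal `I`: `N/IN ≃ M/(ker π ⊔ IM)`, hence equal local lengths. [folklore] -/
theorem lengthAt_quot_smul_top_eq_of_surjective (I : Ideal R) (π : M →ₗ[R] N) (hπ : Function.Surjective π)
    (𝔭 : PrimeSpectrum R) :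
    lengthAt R (N ⧸ (I • (⊤ : Submodule R N))) 𝔭 =
      lengthAt R (M ⧸ (LinearMap.ker π ⊔ I • (⊤ : Submodule R M))) 𝔭 := by
  let q : M →ₗ[R] N ⧸ (I • (⊤ : Submodule R N)) := (Submodule.mkQ _).comp π
  have hq : Function.Surjective q := (Submodule.mkQ_surjective _).comp hπ
  have hker : LinearMap.ker q = LinearMap.ker π ⊔ I • (⊤ : Submodule R M) := by
    rw [LinearMap.ker_comp, Submodule.ker_mkQ,
      show (⊤ : Submodule R N) = Submodule.map π ⊤ by rw [Submodule.map_top, LinearMap.range_eq_top.mpr hπ],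
      ← Submodule.map_smul'', Submodule.comap_map_eq, sup_comm]
  rw [← lengthAt_eq_of_linearEquiv (q.quotKerEquivOfSurjective hq), lengthAt_eq_of_linearEquiv
    (Submodule.quotEquivOfEq _ _ hker)]

/-- For a submodule `S ≤ M` and an ideal `I`: `(M/S)/I(M/S) ≃ M/(S ⊔ IM)`, hence equal local lengths. [folklore] -/
theorem lengthAt_quot_quot_smul_top_eq (I : Ideal R) (S : Submodule R M) (𝔭 : PrimeSpectrum R) :
    lengthAt R ((M ⧸ S) ⧸ (I • (⊤ : Submodule R (M ⧸ S)))) 𝔭 =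
      lengthAt R (M ⧸ (S ⊔ I • (⊤ : Submodule R M))) 𝔭 := by
  rw [lengthAt_quot_smul_top_eq_of_surjective I S.mkQ (Submodule.mkQ_surjective S) 𝔭, Submodule.ker_mkQ]

/-- Right exactness of `− ⊗ R/I` along `P →ι M →π N → 0` (`ι` with range `ker π`, `π` onto), on local lengths:
`ℓ_𝔭(M/IM) ≤ ℓ_𝔭(P/IP) + ℓ_𝔭(N/IN)`. [folklore] -/
theorem lengthAt_quot_smul_top_le_add {P : Type*} [AddCommGroup P] [Module R P] (I : Ideal R)
    (ι : P →ₗ[R] M) (π : M →ₗ[R] N) (hπ : Function.Surjective π) (hex : Function.Exact ι π)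
    (𝔭 : PrimeSpectrum R) :
    lengthAt R (M ⧸ (I • (⊤ : Submodule R M))) 𝔭 ≤
      lengthAt R (P ⧸ (I • (⊤ : Submodule R P))) 𝔭 + lengthAt R (N ⧸ (I • (⊤ : Submodule R N))) 𝔭 := by
  have hker : LinearMap.ker π = LinearMap.range ι := (LinearMap.exact_iff.mp hex)
  -- chain `IM ≤ range ι ⊔ IM ≤ M`
  rw [lengthAt_quot_eq_add_of_le (le_sup_right : I • (⊤ : Submodule R M) ≤ LinearMap.range ι ⊔ I • ⊤) 𝔭,
    lengthAt_quot_smul_top_eq_of_surjective I π hπ 𝔭, hker]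
  gcongr
  -- `(range ι ⊔ IM)/IM` is the image of `P/IP → M/IM`
  have hle : I • (⊤ : Submodule R P) ≤ (I • (⊤ : Submodule R M)).comap ι := by
    rw [← Submodule.map_le_iff_le_comap, Submodule.map_smul'']
    exact Submodule.smul_mono le_rfl le_top
  set ιbar := Submodule.mapQ (I • (⊤ : Submodule R P)) (I • (⊤ : Submodule R M)) ι hle with hιbar
  have hmap : (LinearMap.range ι ⊔ I • (⊤ : Submodule R M)).map (I • (⊤ : Submodule R M)).mkQ =
      LinearMap.range ιbar := by
    rw [Submodule.map_sup, Submodule.mkQ_map_self, sup_bot_eq, ← LinearMap.range_comp, hιbar,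
      ← Submodule.mapQ_mkQ, LinearMap.range_comp, Submodule.range_mkQ, Submodule.map_top]
  rw [hmap]
  exact lengthAt_le_of_surjective ιbar.rangeRestrict ιbar.surjective_rangeRestrict 𝔭

end QuotIdeal

/-! ### §4 The residual length of `Λ²/Λv` and of an extension of a `μ = 0` module by it -/

section LambdaSquare

variable {p : ℕ} [Fact p.Prime]

/-- A cyclic submodule `Λw` with annihilator exactly `(p)` has `ℓ_𝔭(Λw) = 1` at `𝔭 = (p)`. [folklore] -/
theorem lengthAt_span_singleton_eq_one {Q : Type*} [AddCommGroup Q] [Module (IwasawaAlgebra p) Q] (w : Q)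
    (hw : ∀ r : IwasawaAlgebra p, r • w = 0 ↔ r ∈ augIdealP p)
    (𝔭 : PrimeSpectrum (IwasawaAlgebra p)) (h𝔭 : 𝔭.asIdeal = augIdealP p) :
    lengthAt (IwasawaAlgebra p) (Submodule.span (IwasawaAlgebra p) {w}) 𝔭 = 1 := by
  have hker : LinearMap.ker (LinearMap.toSpanSingleton (IwasawaAlgebra p) Q w) = 𝔭.asIdeal := by
    ext r
    rw [LinearMap.mem_ker, LinearMap.toSpanSingleton_apply, hw, h𝔭]
  rw [LinearMap.span_singleton_eq_range,
    ← lengthAt_eq_of_linearEquiv ((LinearMap.toSpanSingleton (IwasawaAlgebra p) Q w).quotKerEquivRange),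
    lengthAt_eq_of_linearEquiv (Submodule.quotEquivOfEq _ _ hker)]
  exact lengthAt_quotient_self 𝔭

/-- `(p)·(Λ × Λ) = (p) × (p)`. [folklore] -/
theorem augIdealP_smul_top_prod :
    augIdealP p • (⊤ : Submodule (IwasawaAlgebra p) (IwasawaAlgebra p × IwasawaAlgebra p)) =
      Submodule.prod (augIdealP p) (augIdealP p) := by
  apply le_antisymm
  · exact Submodule.smul_le.mpr fun r hr m _ ↦
      ⟨Ideal.mul_mem_right _ _ hr, Ideal.mul_mem_right _ _ hr⟩
  · rintro ⟨a, b⟩ ⟨ha, hb⟩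
    obtain ⟨a', rfl⟩ := Ideal.mem_span_singleton'.mp ha
    obtain ⟨b', rfl⟩ := Ideal.mem_span_singleton'.mp hb
    have : (a' * PowerSeries.C (p : ℤ_[p]), b' * PowerSeries.C (p : ℤ_[p])) =
        PowerSeries.C (p : ℤ_[p]) • ((a', b') : IwasawaAlgebra p × IwasawaAlgebra p) := by
      ext <;> simp [mul_comm]
    rw [this]
    exact Submodule.smul_mem_smul (Ideal.mem_span_singleton_self _) Submodule.mem_top

/-- `ℓ_𝔭((Λ × Λ)/(p)(Λ × Λ)) = 2` at `𝔭 = (p)`. [folklore] -/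
theorem lengthAt_prod_quot_augIdealP (𝔭 : PrimeSpectrum (IwasawaAlgebra p)) (h𝔭 : 𝔭.asIdeal = augIdealP p) :
    lengthAt (IwasawaAlgebra p) ((IwasawaAlgebra p × IwasawaAlgebra p) ⧸
      (augIdealP p • (⊤ : Submodule (IwasawaAlgebra p) (IwasawaAlgebra p × IwasawaAlgebra p)))) 𝔭 = 2 := by
  let φ : (IwasawaAlgebra p × IwasawaAlgebra p) →ₗ[IwasawaAlgebra p]
      (IwasawaAlgebra p ⧸ augIdealP p) × (IwasawaAlgebra p ⧸ augIdealP p) :=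
    (Submodule.mkQ (augIdealP p)).prodMap (Submodule.mkQ (augIdealP p))
  have hφ : Function.Surjective φ :=
    Function.Surjective.prodMap (Submodule.mkQ_surjective _) (Submodule.mkQ_surjective _)
  have hker : LinearMap.ker φ = augIdealP p • ⊤ := by
    rw [LinearMap.ker_prodMap, Submodule.ker_mkQ, augIdealP_smul_top_prod]
  rw [← lengthAt_eq_of_linearEquiv (Submodule.quotEquivOfEq _ _ hker),
    lengthAt_eq_of_linearEquiv (φ.quotKerEquivOfSurjective hφ), lengthAt_prod, ← h𝔭, lengthAt_quotient_self]
  rfl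

/-- For `v ∈ Λ × Λ` NOT in `(p)(Λ × Λ)`: `ℓ_𝔭((Λ × Λ)/(Λv + (p)(Λ × Λ))) = 1` at `𝔭 = (p)` (the quotient
`Ω²/Ω v̄`, `Ω = Λ/(p)` a domain, `v̄ ≠ 0`, has `Ω`-rank one). [folklore] -/
theorem lengthAt_quot_span_sup_eq_one (𝔭 : PrimeSpectrum (IwasawaAlgebra p)) (h𝔭 : 𝔭.asIdeal = augIdealP p)
    (v : IwasawaAlgebra p × IwasawaAlgebra p)
    (hv : v ∉ augIdealP p • (⊤ : Submodule (IwasawaAlgebra p) (IwasawaAlgebra p × IwasawaAlgebra p))) :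
    lengthAt (IwasawaAlgebra p) ((IwasawaAlgebra p × IwasawaAlgebra p) ⧸
      (Submodule.span (IwasawaAlgebra p) {v} ⊔
        augIdealP p • (⊤ : Submodule (IwasawaAlgebra p) (IwasawaAlgebra p × IwasawaAlgebra p)))) 𝔭 = 1 := by
  set N₀ := augIdealP p • (⊤ : Submodule (IwasawaAlgebra p) (IwasawaAlgebra p × IwasawaAlgebra p)) with hN₀
  haveI : (augIdealP p).IsPrime := isPrime_augIdealP_holds p
  -- the image of `Λv` in `(Λ × Λ)/N₀` is cyclic with annihilator `(p)`
  have hw : ∀ r : IwasawaAlgebra p, r • (Submodule.Quotient.mk v : (IwasawaAlgebra p × IwasawaAlgebra p) ⧸ N₀) = 0 ↔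
      r ∈ augIdealP p := by
    intro r
    rw [← Submodule.Quotient.mk_smul, Submodule.Quotient.mk_eq_zero]
    constructor
    · intro h
      rw [hN₀, augIdealP_smul_top_prod] at h hv
      obtain ⟨h1, h2⟩ := h
      simp only [Prod.smul_fst, Prod.smul_snd, smul_eq_mul] at h1 h2
      by_contra hr
      apply hv
      exact ⟨(Ideal.IsPrime.mem_or_mem ‹_› h1).resolve_left hr, (Ideal.IsPrime.mem_or_mem ‹_› h2).resolve_left hr⟩
    · intro hr
      exact Submodule.smul_mem_smul hr Submodule.mem_top
  have hchain := lengthAt_quot_eq_add_of_le (le_sup_right : N₀ ≤ Submodule.span (IwasawaAlgebra p) {v} ⊔ N₀) 𝔭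
  rw [lengthAt_prod_quot_augIdealP 𝔭 h𝔭, Submodule.map_sup, Submodule.mkQ_map_self, sup_bot_eq,
    Submodule.map_span, Set.image_singleton, Submodule.mkQ_apply,
    lengthAt_span_singleton_eq_one _ hw 𝔭 h𝔭] at hchain
  -- `2 = 1 + ℓ` in `ℕ∞`
  have h2 : (2 : ℕ∞) = 1 + 1 := rfl
  rw [h2] at hchain
  apply le_antisymm
  · exact WithTop.le_of_add_le_add_left WithTop.one_ne_top hchain.ge
  · exact WithTop.le_of_add_le_add_left WithTop.one_ne_top hchain.le

/-- For `0 ≠ v ∈ (p)(Λ × Λ)`, the quotient `P = (Λ × Λ)/Λv` contains a cyclic TORSION submodule with annihilator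
`(p)` (generated by the class of `v/p`), so `ℓ_𝔭(torsion P) ≥ 1`. [folklore] -/
theorem one_le_lengthAt_torsion_quot_span_of_mem (𝔭 : PrimeSpectrum (IwasawaAlgebra p)) (h𝔭 : 𝔭.asIdeal = augIdealP p)
    (v : IwasawaAlgebra p × IwasawaAlgebra p) (hv0 : v ≠ 0)
    (hv : v ∈ augIdealP p • (⊤ : Submodule (IwasawaAlgebra p) (IwasawaAlgebra p × IwasawaAlgebra p))) :
    1 ≤ lengthAt (IwasawaAlgebra p) (Submodule.torsion (IwasawaAlgebra p)
      ((IwasawaAlgebra p × IwasawaAlgebra p) ⧸ Submodule.span (IwasawaAlgebra p) {v})) 𝔭 := by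
  set π₀ : IwasawaAlgebra p := PowerSeries.C (p : ℤ_[p]) with hπ₀
  have hπ₀0 : π₀ ≠ 0 := C_natCast_p_ne_zero p
  rw [show augIdealP p = Ideal.span {π₀} from rfl, Submodule.ideal_span_singleton_smul,
    Submodule.mem_smul_pointwise_iff_exists] at hv
  obtain ⟨v', -, rfl⟩ := hv
  have hv'0 : v' ≠ 0 := by rintro rfl; exact hv0 (smul_zero _)
  set P := (IwasawaAlgebra p × IwasawaAlgebra p) ⧸ Submodule.span (IwasawaAlgebra p) {π₀ • v'}
  set w : P := Submodule.Quotient.mk v' with hwdef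
  -- annihilator of `w` is `(p)`
  have hw : ∀ r : IwasawaAlgebra p, r • w = 0 ↔ r ∈ augIdealP p := by
    intro r
    rw [hwdef, ← Submodule.Quotient.mk_smul, Submodule.Quotient.mk_eq_zero, Submodule.mem_span_singleton]
    constructor
    · rintro ⟨μ, hμ⟩
      -- `μ • π₀ • v' = r • v'` forces `r = μ π₀`
      have h0 : (r - μ * π₀) • v' = 0 := by rw [sub_smul, mul_smul, hμ, sub_self]
      rw [smul_eq_zero] at h0
      rcases h0 with h0 | h0
      · rw [sub_eq_zero] at h0
        rw [h0]
        exact Ideal.mul_mem_left _ _ (Ideal.mem_span_singleton_self _)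
      · exact absurd h0 hv'0
    · intro hr
      obtain ⟨μ, rfl⟩ := Ideal.mem_span_singleton'.mp hr
      exact ⟨μ, by rw [mul_smul]⟩
  -- `Λw ≤ torsion P` (killed by `π₀`, a non-zero-divisor)
  have hwt : Submodule.span (IwasawaAlgebra p) {w} ≤ Submodule.torsion (IwasawaAlgebra p) P := by
    rw [Submodule.span_singleton_le_iff_mem]
    refine ⟨⟨π₀, mem_nonZeroDivisors_of_ne_zero hπ₀0⟩, ?_⟩
    change π₀ • w = 0
    exact (hw π₀).mpr (Ideal.mem_span_singleton_self _)
  calc (1 : ℕ∞) = lengthAt (IwasawaAlgebra p) (Submodule.span (IwasawaAlgebra p) {w}) 𝔭 :=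
        (lengthAt_span_singleton_eq_one w hw 𝔭 h𝔭).symm
    _ ≤ _ := lengthAt_le_of_injective (Submodule.inclusion hwt) (Submodule.inclusion_injective hwt) 𝔭

/-- **The residual length of an extension `0 → Λ²/Λv → X → Y → 0`.** If `v ≠ 0`, the torsion submodule of `X`
has `ℓ_𝔭 = 0` and `ℓ_𝔭(Y/(p)Y) = 0` (at `𝔭 = (p)`), then `ℓ_𝔭(X/(p)X) ≤ 1`. [folklore] -/
theorem lengthAt_quot_le_one_of_extension {X Y : Type*} [AddCommGroup X] [Module (IwasawaAlgebra p) X]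
    [AddCommGroup Y] [Module (IwasawaAlgebra p) Y]
    (𝔭 : PrimeSpectrum (IwasawaAlgebra p)) (h𝔭 : 𝔭.asIdeal = augIdealP p)
    (v : IwasawaAlgebra p × IwasawaAlgebra p) (hv0 : v ≠ 0)
    (ι : ((IwasawaAlgebra p × IwasawaAlgebra p) ⧸ Submodule.span (IwasawaAlgebra p) {v}) →ₗ[IwasawaAlgebra p] X)
    (π : X →ₗ[IwasawaAlgebra p] Y) (hι : Function.Injective ι) (hπ : Function.Surjective π)
    (hex : Function.Exact ι π)
    (hT : lengthAt (IwasawaAlgebra p) (Submodule.torsion (IwasawaAlgebra p) X) 𝔭 = 0)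
    (hY : lengthAt (IwasawaAlgebra p) (Y ⧸ (augIdealP p • (⊤ : Submodule (IwasawaAlgebra p) Y))) 𝔭 = 0) :
    lengthAt (IwasawaAlgebra p) (X ⧸ (augIdealP p • (⊤ : Submodule (IwasawaAlgebra p) X))) 𝔭 ≤ 1 := by
  refine (lengthAt_quot_smul_top_le_add (augIdealP p) ι π hπ hex 𝔭).trans ?_
  rw [hY, add_zero, lengthAt_quot_quot_smul_top_eq]
  by_cases hvN : v ∈ augIdealP p • (⊤ : Submodule (IwasawaAlgebra p) (IwasawaAlgebra p × IwasawaAlgebra p))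
  · -- impossible: `X` would contain the torsion class of `v/p`
    exfalso
    have h1 := one_le_lengthAt_torsion_quot_span_of_mem 𝔭 h𝔭 v hv0 hvN
    -- `ι` maps the torsion of `P` into the torsion of `X`
    have hmap : ∀ x ∈ Submodule.torsion (IwasawaAlgebra p)
        ((IwasawaAlgebra p × IwasawaAlgebra p) ⧸ Submodule.span (IwasawaAlgebra p) {v}),
        ι x ∈ Submodule.torsion (IwasawaAlgebra p) X := by
      rintro x ⟨a, ha⟩
      exact ⟨a, by rw [Submonoid.smul_def, ← map_smul, ← Submonoid.smul_def, ha, map_zero]⟩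
    have h2 := lengthAt_le_of_injective ((ι.domRestrict _).codRestrict (Submodule.torsion (IwasawaAlgebra p) X)
      fun x ↦ hmap x x.2) (fun x y hxy ↦ by
        apply Subtype.ext
        apply hι
        simpa using congrArg Subtype.val hxy) 𝔭
    rw [hT] at h2
    exact absurd (h1.trans h2) (by decide)
  · exact (lengthAt_quot_span_sup_eq_one 𝔭 h𝔭 v hvN).le

end LambdaSquare

end Summit.BirchSwinnertonDyer.BirchSwinnertonDyer.Theorems.SmallImageFinePivot

end
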